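import Summits.KontsevichZagierPeriods.KontsevichZagierPeriods.Theorems.LinRedNormalFormArrangementNormalFormStubRebaseSimplePosOneFibreApex

/-!
# Stub `stub_rebaseSimplePosOnePos` (crux `ArrangementNormalForm`, line `janus-bands`) —
part `DCornerPar`: the double-corner bands reduce to PARALLEL bands, in every base dimension

The two residual hypotheses `Hdthick` / `Hdfar` of the one-fibre rebase
(`rebaseSimplePos_oneFibre_of_double'`, and `rebaseSimplePosOnePos_two_of_U'` at `B = 2`) concern
a lettered band `u < t < v` above its letter `0` over a base of dimension `B + 1`, with a `y`-free
apex level `κ`, `u − κ = A (v − u)`, `A > 0`, in the thick regime `κ < 0 < u < v` or the far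
regime `0 < κ`, `u < v`, `2κ ≤ v`. They follow from the hypothesis `Hpar` on PARALLEL bands ALONE
(same base factor, same base pole), WITHOUT any corner analysis or blow-up
(`RebasePos.good_dthick_of_par`, `RebasePos.good_dfar_of_par`). With `λ = A/(A+1)` and the affine
level `w₁ = λ v`:
* `u − w₁ = κ/(A+1)` is `y`-FREE, so the band `(u, w₁)` (resp. `(w₁, u)`) is parallel;
* `w₁ = A (v − w₁)`: the band `(w₁, v)` is COAXIAL with the letter `0`, hence literally in
  `GG B 2 1` after the blow-up `t = σ (v − w₁)` (`RebasePos.good_coaxial`, rule 2);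
* thick regime: `u < w₁ < v` on the cell; cut the fibre at `w₁` (rule 1a, `RebasePos.cutFibre`):
  the lower piece is a parallel band above the letter (`Hpar`), the upper piece is coaxial;
* far regime: `0 < w₁ < u < v`; Janus-extend the lower bound down to `w₁` (rule 1a,
  `RebasePos.janusExtendLo`): the wedge `(w₁, u)` converges absolutely by
  `RebasePos.integrableOn_wedge_near` (`u − w₁ = κ/(A+1) ≤ v − u` because `κ ≤ (A+1)(v − u)`, and
  `v = ((A+1)/A) w₁`), it is a parallel band above the letter (`Hpar`), and the extended band
  `(w₁, v)` is coaxial.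
Registered as `rebaseSimplePos_dthick_of_par` (the thick regime; the far regime rides along as
`rebaseSimplePos_dfar_of_par`).

References: M. Kontsevich, D. Zagier, *Periods* (2001), §1.2, rules (1a), (2).
-/

noncomputable section

open Set MeasureTheory MvPolynomial
open Literature.NumberTheory.Transcendental Literature.ModelTheory.ExponentialFields

namespace Summit.KontsevichZagierPeriods.ArrangementNormalForm.JanusBands

namespace RebasePos

open SeparatePos

section DCornerPar

variable {B m m' : ℕ}

/-- The two affine identities of the coaxial level `w₁ = (A/(A+1)) v` of an apex configuration
`u − κ = A (v − u)`: `u − w₁ = κ/(A+1)` and `v − w₁ = v/(A+1)`. -/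
theorem affF_coaxLevel (u v κ : (Fin (B + 1) → ℚ) × ℚ) (A : ℚ) (hA : u - κ = A • (v - u))
    (hA0 : 0 < A) (z : Fin (B + 1 + 1) → ℝ) :
    affF B 1 u z - affF B 1 ((A / (A + 1)) • v) z = affF B 1 κ z / (A + 1) ∧
    affF B 1 v z - affF B 1 ((A / (A + 1)) • v) z = affF B 1 v z / (A + 1) := by
  have hA1 : (A : ℝ) + 1 ≠ 0 := by
    have : (0 : ℝ) < A := by exact_mod_cast hA0
    exact ne_of_gt (by linarith)
  have h := congrArg (fun d => affF B 1 d z) hA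
  simp only [affF_sub'', affF_smul'] at h
  rw [affF_smul']
  push_cast
  constructor
  · field_simp
    linear_combination h
  · field_simp
    ring

/-- The `y`-slope of the coaxial level is the `y`-slope of the lower bound. -/
theorem coaxLevel_last (u v κ : (Fin (B + 1) → ℚ) × ℚ) (A : ℚ) (hκ : κ.1 (Fin.last B) = 0)
    (hA : u - κ = A • (v - u)) (hA0 : 0 < A) :
    ((A / (A + 1)) • v).1 (Fin.last B) = u.1 (Fin.last B) := by
  have hA1 : A + 1 ≠ 0 := ne_of_gt (by linarith)
  have h := congrArg (fun d : (Fin (B + 1) → ℚ) × ℚ => d.1 (Fin.last B)) hA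
  simp only [Prod.fst_sub, Pi.sub_apply, Prod.smul_fst, Pi.smul_apply, smul_eq_mul, hκ,
    sub_zero] at h
  simp only [Prod.smul_fst, Pi.smul_apply, smul_eq_mul]
  field_simp
  linear_combination -h

/-- The level `w₁ = (A/(A+1)) v` is coaxial with the letter `0`: `w₁ − 0 = A (v − w₁)`. -/
theorem coaxLevel_eq (v : (Fin (B + 1) → ℚ) × ℚ) (A : ℚ) (hA0 : 0 < A) :
    (A / (A + 1)) • v - 0 = A • (v - (A / (A + 1)) • v) := by
  have hA1 : A + 1 ≠ 0 := ne_of_gt (by linarith)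
  rw [sub_zero, smul_sub, smul_smul, ← sub_smul]
  congr 1
  field_simp
  ring

variable (L : Fin m → (Fin B → ℚ) × ℚ) (e : Fin m → ℕ) (ℓ₁ ℓ₂ : (Fin B → ℚ) × ℚ)

/-- **`Hdthick` from `Hpar`, every base dimension.** A band above its letter `0` in the thick
regime `κ < 0 < u < v` (`u − κ = A (v − u)`, `A > 0`, `κ` free of `y`) is congruent modulo
`KZ.relations` to the subgroup generated by `GG B 2 1` as soon as the PARALLEL bands above the
letter with the same base factor are: fibre cut at the coaxial level `w₁ = (A/(A+1)) v` (rule 1a),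
parallel piece `(u, w₁)` by `Hpar`, coaxial piece `(w₁, v)` by `good_coaxial` (rule 2). -/
theorem good_dthick_of_par (s : KZ.IntegralRep (B + 1 + 1)) (M : Fin m' → (Fin (B + 1) → ℚ) × ℚ)
    (p : MvPolynomial (Fin B) ℚ) (u v κ : (Fin (B + 1) → ℚ) × ℚ) (A : ℚ)
    (hbd : Bornology.IsBounded s.domain)
    (hdom : s.domain = gDom B 1 m' M (fun _ => Sum.inr u) (fun _ => Sum.inr v))
    (hint : EqOn s.integrand (glit B 1 p L e ℓ₁ ℓ₂ 0 1 (fun _ => some 0)) s.domain)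
    (hκ : κ.1 (Fin.last B) = 0) (hA : u - κ = A • (v - u)) (hA0 : 0 < A)
    (hcell : ∀ z : Fin (B + 1 + 1) → ℝ, (∀ j, 0 < affF B 1 (M j) z) →
      affF B 1 κ z < 0 ∧ 0 < affF B 1 u z ∧ affF B 1 u z < affF B 1 v z)
    (Hpar : ∀ (m'' : ℕ) (s' : KZ.IntegralRep (B + 1 + 1)) (M' : Fin m'' → (Fin (B + 1) → ℚ) × ℚ)
      (u' v' : (Fin (B + 1) → ℚ) × ℚ), Bornology.IsBounded s'.domain →
      s'.domain = gDom B 1 m'' M' (fun _ => Sum.inr u') (fun _ => Sum.inr v') →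
      EqOn s'.integrand (glit B 1 p L e ℓ₁ ℓ₂ 0 1 (fun _ => some 0)) s'.domain →
      u'.1 (Fin.last B) ≠ 0 → u'.1 (Fin.last B) = v'.1 (Fin.last B) →
      (∀ z : Fin (B + 1 + 1) → ℝ, (∀ j, 0 < affF B 1 (M' j) z) →
        0 < affF B 1 u' z ∧ affF B 1 u' z < affF B 1 v' z) →
      ∃ c ∈ AddSubgroup.closure (GGset B 2 1), KZ.of s' - c ∈ KZ.relations) :
    ∃ c ∈ AddSubgroup.closure (GGset B 2 1), KZ.of s - c ∈ KZ.relations := by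
  -- a `y`-free lower bound: the product case
  by_cases huy : u.1 (Fin.last B) = 0
  · exact good_product (fun _ => some 0) (fun _ => u) (fun _ => v) s M L e p ℓ₁ ℓ₂ (fun _ => Sum.inr u)
      (fun _ => Sum.inr v) (Or.inl rfl) hbd hdom hint (fun _ => rfl) (fun _ => rfl)
      fun _ c hc => Or.inl (by cases hc; simpa using huy)
  set w₁ : (Fin (B + 1) → ℚ) × ℚ := (A / (A + 1)) • v with hw₁
  have hA1 : (0 : ℝ) < A + 1 := by
    have : (0 : ℝ) < A := by exact_mod_cast hA0
    linarith
  -- geometry on the base cell: `u < w₁ < v`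
  have hgeo : ∀ z : Fin (B + 1 + 1) → ℝ, (∀ j, 0 < affF B 1 (M j) z) →
      affF B 1 u z < affF B 1 w₁ z ∧ affF B 1 w₁ z < affF B 1 v z := by
    intro z hz
    obtain ⟨hκ0, hu0, huv⟩ := hcell z hz
    obtain ⟨h1, h2⟩ := affF_coaxLevel u v κ A hA hA0 z
    have hv0 : 0 < affF B 1 v z := hu0.trans huv
    have h3 : affF B 1 κ z / (A + 1) < 0 := div_neg_of_neg_of_pos hκ0 hA1
    have h4 : 0 < affF B 1 v z / (A + 1) := div_pos hv0 hA1
    constructor <;> linarith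
  -- cut the fibre at `w₁` (rule 1a)
  obtain ⟨s₁, s₂, hd₁, hd₂, hi₁, hi₂, hsub₁, hsub₂, hrel⟩ := cutFibre s M (fun _ => Sum.inr u)
    (fun _ => Sum.inr v) hdom 0 w₁
    (fun z hz => by
      rw [update_fin_one, mem_gDom_one] at hz
      exact (hgeo z hz.1).2.le)
    (fun z hz => by
      rw [update_fin_one, mem_gDom_one] at hz
      exact (hgeo z hz.1).1.le)
  rw [update_fin_one] at hd₁ hd₂
  refine good_of_split hrel ?_ ?_
  · -- the parallel piece `(u, w₁)`
    exact Hpar m' s₁ M u w₁ (hbd.subset hsub₁) hd₁ (by rw [hi₁]; exact hint.mono hsub₁) huy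
      (coaxLevel_last u v κ A hκ hA hA0).symm fun z hz => ⟨(hcell z hz).2.1, (hgeo z hz).1⟩
  · -- the coaxial piece `(w₁, v)`
    exact good_coaxial 0 s₂ M L e p ℓ₁ ℓ₂ 0 1 w₁ v A (Or.inl rfl) (hbd.subset hsub₂) hd₂
      (by rw [hi₂]; exact hint.mono hsub₂) (coaxLevel_eq v A hA0) fun z hz => (hgeo z hz).2

/-- **`Hdfar` from `Hpar`, every base dimension.** A band above its letter `0` in the far regime
`0 < κ`, `u < v`, `2κ ≤ v` (`u − κ = A (v − u)`, `A > 0`, `κ` free of `y`) is congruent modulo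
`KZ.relations` to the subgroup generated by `GG B 2 1` as soon as the PARALLEL bands above the
letter with the same base factor are: Janus extension of the lower bound down to the coaxial
level `w₁ = (A/(A+1)) v` (rule 1a; the wedge `(w₁, u)` is dominated,
`integrableOn_wedge_near`), wedge by `Hpar`, extended coaxial band `(w₁, v)` by `good_coaxial`. -/
theorem good_dfar_of_par (s : KZ.IntegralRep (B + 1 + 1)) (M : Fin m' → (Fin (B + 1) → ℚ) × ℚ)
    (p : MvPolynomial (Fin B) ℚ) (u v κ : (Fin (B + 1) → ℚ) × ℚ) (A : ℚ)
    (hbd : Bornology.IsBounded s.domain)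
    (hdom : s.domain = gDom B 1 m' M (fun _ => Sum.inr u) (fun _ => Sum.inr v))
    (hint : EqOn s.integrand (glit B 1 p L e ℓ₁ ℓ₂ 0 1 (fun _ => some 0)) s.domain)
    (hκ : κ.1 (Fin.last B) = 0) (hA : u - κ = A • (v - u)) (hA0 : 0 < A)
    (hcell : ∀ z : Fin (B + 1 + 1) → ℝ, (∀ j, 0 < affF B 1 (M j) z) →
      0 < affF B 1 κ z ∧ affF B 1 u z < affF B 1 v z ∧ 2 * affF B 1 κ z ≤ affF B 1 v z)
    (Hpar : ∀ (m'' : ℕ) (s' : KZ.IntegralRep (B + 1 + 1)) (M' : Fin m'' → (Fin (B + 1) → ℚ) × ℚ)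
      (u' v' : (Fin (B + 1) → ℚ) × ℚ), Bornology.IsBounded s'.domain →
      s'.domain = gDom B 1 m'' M' (fun _ => Sum.inr u') (fun _ => Sum.inr v') →
      EqOn s'.integrand (glit B 1 p L e ℓ₁ ℓ₂ 0 1 (fun _ => some 0)) s'.domain →
      u'.1 (Fin.last B) ≠ 0 → u'.1 (Fin.last B) = v'.1 (Fin.last B) →
      (∀ z : Fin (B + 1 + 1) → ℝ, (∀ j, 0 < affF B 1 (M' j) z) →
        0 < affF B 1 u' z ∧ affF B 1 u' z < affF B 1 v' z) →
      ∃ c ∈ AddSubgroup.closure (GGset B 2 1), KZ.of s' - c ∈ KZ.relations) :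
    ∃ c ∈ AddSubgroup.closure (GGset B 2 1), KZ.of s - c ∈ KZ.relations := by
  -- a `y`-free lower bound: the product case
  by_cases huy : u.1 (Fin.last B) = 0
  · exact good_product (fun _ => some 0) (fun _ => u) (fun _ => v) s M L e p ℓ₁ ℓ₂ (fun _ => Sum.inr u)
      (fun _ => Sum.inr v) (Or.inl rfl) hbd hdom hint (fun _ => rfl) (fun _ => rfl)
      fun _ c hc => Or.inl (by cases hc; simpa using huy)
  set w₁ : (Fin (B + 1) → ℚ) × ℚ := (A / (A + 1)) • v with hw₁
  have hA0' : (0 : ℝ) < A := by exact_mod_cast hA0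
  have hA1 : (0 : ℝ) < A + 1 := by linarith
  -- geometry on the base cell: `0 < w₁ < u < v`, the wedge is dominated
  have hgeo : ∀ z : Fin (B + 1 + 1) → ℝ, (∀ j, 0 < affF B 1 (M j) z) →
      0 < affF B 1 w₁ z ∧ affF B 1 w₁ z < affF B 1 u z ∧ affF B 1 u z < affF B 1 v z ∧
      affF B 1 u z - affF B 1 w₁ z ≤ affF B 1 v z - affF B 1 u z ∧
      affF B 1 v z ≤ ((A + 1) / A : ℝ) * affF B 1 w₁ z := by
    intro z hz
    obtain ⟨hκ0, huv, h2κ⟩ := hcell z hz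
    obtain ⟨h1, h2⟩ := affF_coaxLevel u v κ A hA hA0 z
    have hv0 : 0 < affF B 1 v z := by linarith
    have hw : affF B 1 w₁ z = (A / (A + 1) : ℝ) * affF B 1 v z := by
      rw [hw₁, affF_smul']
      push_cast
      ring
    have h3 : 0 < affF B 1 κ z / (A + 1) := div_pos hκ0 hA1
    have h4 : affF B 1 κ z / (A + 1) ≤ affF B 1 v z / (A + 1) - affF B 1 κ z / (A + 1) := by
      rw [← sub_div, le_div_iff₀ hA1, div_mul_cancel₀ _ hA1.ne']
      linarith
    refine ⟨?_, by linarith, huv, by linarith, ?_⟩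
    · rw [hw]
      exact mul_pos (div_pos hA0' hA1) hv0
    · rw [hw]
      field_simp
      exact le_rfl
  -- the lower wedge `(w₁, u)` converges (near regime of the level `w₁`)
  have hWint : IntegrableOn (glit B 1 p L e ℓ₁ ℓ₂ 0 1 (fun _ => some 0))
      (gDom B 1 m' M (fun _ => Sum.inr w₁) (fun _ => Sum.inr u)) :=
    integrableOn_wedge_near s M p L e ℓ₁ ℓ₂ 0 1 0 u v w₁ hdom hint 1 ((A + 1) / A) one_pos fun z hz => by
      obtain ⟨h0, hwu, -, hlen, hC⟩ := hgeo z hz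
      refine ⟨by rwa [affF_zero''], hwu.le, by rwa [Rat.cast_one, one_mul], ?_⟩
      rwa [affF_zero'', sub_zero, sub_zero]
  obtain ⟨sT, sW, hdT, hiT, hbdT, hdW, hiW, hbdW, hrel⟩ := janusExtendLo s M (fun _ => Sum.inr u)
    (fun _ => Sum.inr v) hdom L e p ℓ₁ ℓ₂ 0 1 (fun _ => some 0) hint 0 u w₁ rfl
    (fun z hz => (hgeo z hz).2.1.le) (fun z hz => le_of_lt (hgeo z hz.1).2.2.1)
    (by rw [update_fin_one, update_fin_one]; exact hWint)
    (by rw [update_fin_one]; exact isBounded_gDom_one M u v w₁ v (hdom ▸ hbd) fun z hz => (hgeo z hz).2.2.1)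
  rw [update_fin_one] at hdT hdW
  rw [update_fin_one] at hdW
  refine good_of_janus hrel ?_ ?_
  · -- the extended band `(w₁, v)` is coaxial
    exact good_coaxial 0 sT M L e p ℓ₁ ℓ₂ 0 1 w₁ v A (Or.inl rfl) hbdT hdT
      (by rw [hiT]; exact fun _ _ => rfl) (coaxLevel_eq v A hA0)
      fun z hz => (hgeo z hz).2.1.trans (hgeo z hz).2.2.1
  · -- the wedge `(w₁, u)` is a parallel band above the letter
    have hsl := coaxLevel_last u v κ A hκ hA hA0
    exact Hpar m' sW M w₁ u hbdW hdW (by rw [hiW]; exact fun _ _ => rfl) (by rw [hsl]; exact huy) hsl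
      fun z hz => ⟨(hgeo z hz).1, (hgeo z hz).2.1⟩

end DCornerPar

end RebasePos

/-- **Registered part of `stub_rebaseSimplePosOnePos` (line `janus-bands`): the residual
hypothesis `Hdthick` of the one-fibre rebase follows from `Hpar`, in every base dimension.** A
lettered band `u < t < v` above its letter `0` over a base of dimension `B + 1` (base factor
`p(x')/∏ Lⱼ(x')^{eⱼ} · 1/(y − ℓ₂(x'))`) in the thick regime `κ < 0 < u < v` of a `y`-free apex
level `κ` (`u − κ = A (v − u)`, `A > 0`) is congruent modulo `KZ.relations` to the subgroup
generated by `GG B 2 1` as soon as the PARALLEL bands above the letter with the same base factor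
are (`RebasePos.good_dthick_of_par`: fibre cut at the coaxial level `(A/(A+1)) v`, rules 1a, 2).
No corner hypothesis is needed. -/
theorem rebaseSimplePos_dthick_of_par (B m m' : ℕ) (L : Fin m → (Fin B → ℚ) × ℚ) (e : Fin m → ℕ) (ℓ₁ ℓ₂ : (Fin B → ℚ) × ℚ) (s : KZ.IntegralRep (B + 1 + 1)) (M : Fin m' → (Fin (B + 1) → ℚ) × ℚ) (p : MvPolynomial (Fin B) ℚ) (u v κ : (Fin (B + 1) → ℚ) × ℚ) (A : ℚ) (hbd : Bornology.IsBounded s.domain) (hdom : s.domain = SeparatePos.gDom B 1 m' M (fun _ => Sum.inr u) (fun _ => Sum.inr v)) (hint : Set.EqOn s.integrand (RebasePos.glit B 1 p L e ℓ₁ ℓ₂ 0 1 (fun _ => some 0)) s.domain) (hκ : κ.1 (Fin.last B) = 0) (hA : u - κ = A • (v - u)) (hA0 : 0 < A) (hcell : ∀ z : Fin (B + 1 + 1) → ℝ, (∀ j, 0 < SeparatePos.affF B 1 (M j) z) → SeparatePos.affF B 1 κ z < 0 ∧ 0 < SeparatePos.affF B 1 u z ∧ SeparatePos.affF B 1 u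 z < SeparatePos.affF B 1 v z) (Hpar : ∀ (m'' : ℕ) (s' : KZ.IntegralRep (B + 1 + 1)) (M' : Fin m'' → (Fin (B + 1) → ℚ) × ℚ) (u' v' : (Fin (B + 1) → ℚ) × ℚ), Bornology.IsBounded s'.domain → s'.domain = SeparatePos.gDom B 1 m'' M' (fun _ => Sum.inr u') (fun _ => Sum.inr v') → Set.EqOn s'.integrand (RebasePos.glit B 1 p L e ℓ₁ ℓ₂ 0 1 (fun _ => some 0)) s'.domain → u'.1 (Fin.last B) ≠ 0 → u'.1 (Fin.last B) = v'.1 (Fin.last B) → (∀ z : Fin (B + 1 + 1) → ℝ, (∀ j, 0 < SeparatePos.affF B 1 (M' j) z) → 0 < SeparatePos.affF B 1 u' z ∧ SeparatePos.affF B 1 u' z < SeparatePos.affF B 1 v' z) → ∃ c ∈ AddSubgroup.closure (SeparatePos.GGset B 2 1), KZ.of s' - c ∈ KZ.relations) : ∃ c ∈ AddSubgroup.closure (SeparatePos.GGset B 2 1), KZ.of s - c ∈ KZ.relations :=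
  RebasePos.good_dthick_of_par L e ℓ₁ ℓ₂ s M p u v κ A hbd hdom hint hκ hA hA0 hcell Hpar

/-- **The residual hypothesis `Hdfar` of the one-fibre rebase follows from `Hpar`, in every base
dimension** (far regime `0 < κ`, `u < v`, `2κ ≤ v`; `RebasePos.good_dfar_of_par`: Janus extension
of the lower bound down to the coaxial level, dominated wedge, rules 1a, 2). -/
theorem rebaseSimplePos_dfar_of_par (B m m' : ℕ) (L : Fin m → (Fin B → ℚ) × ℚ) (e : Fin m → ℕ) (ℓ₁ ℓ₂ : (Fin B → ℚ) × ℚ) (s : KZ.IntegralRep (B + 1 + 1)) (M : Fin m' → (Fin (B + 1) → ℚ) × ℚ) (p : MvPolynomial (Fin B) ℚ) (u v κ : (Fin (B + 1) → ℚ) × ℚ) (A : ℚ) (hbd : Bornology.IsBounded s.domain) (hdom : s.domain = SeparatePos.gDom B 1 m' M (fun _ => Sum.inr u) (fun _ => Sum.inr v)) (hint : Set.EqOn s.integrand (RebasePos.glit B 1 p L e ℓ₁ ℓ₂ 0 1 (fun _ => some 0)) s.domain) (hκ : κ.1 (Fin.last B) = 0) (hA : u - κ = A • (v - u)) (hA0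 : 0 < A) (hcell : ∀ z : Fin (B + 1 + 1) → ℝ, (∀ j, 0 < SeparatePos.affF B 1 (M j) z) → 0 < SeparatePos.affF B 1 κ z ∧ SeparatePos.affF B 1 u z < SeparatePos.affF B 1 v z ∧ 2 * SeparatePos.affF B 1 κ z ≤ SeparatePos.affF B 1 v z) (Hpar : ∀ (m'' : ℕ) (s' : KZ.IntegralRep (B + 1 + 1)) (M' : Fin m'' → (Fin (B + 1) → ℚ) × ℚ) (u' v' : (Fin (B + 1) → ℚ) × ℚ), Bornology.IsBounded s'.domain → s'.domain = SeparatePos.gDom B 1 m'' M' (fun _ => Sum.inr u') (fun _ => Sum.inr v') → Set.EqOn s'.integrand (RebasePos.glit B 1 p L e ℓ₁ ℓ₂ 0 1 (fun _ => some 0)) s'.domain → u'.1 (Fin.last B) ≠ 0 → u'.1 (Fin.last B) = v'.1 (Fin.last B) → (∀ z : Fin (B + 1 + 1) → ℝ, (∀ j, 0 < SeparatePos.affF B 1 (M' j) z) → 0 < SeparatePos.affF B 1 u' z ∧ SeparatePos.affF B 1 u' z < SeparatePos.affF B 1 v' z) → ∃ c ∈ AddSubgroup.closure (SeparatePos.GGset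 B 2 1), KZ.of s' - c ∈ KZ.relations) : ∃ c ∈ AddSubgroup.closure (SeparatePos.GGset B 2 1), KZ.of s - c ∈ KZ.relations :=
  RebasePos.good_dfar_of_par L e ℓ₁ ℓ₂ s M p u v κ A hbd hdom hint hκ hA hA0 hcell Hpar

end Summit.KontsevichZagierPeriods.ArrangementNormalForm.JanusBands
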